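import Summits.Parity.BatemanHorn.Theorems.SoloInformedTwinBoxClassBounds

/-!
# The unbalanced twin sum, regime (1b) — V: class totals over all boxes and moduli

Soloist file (informed mode), file F4c-β2 of the kernel project for (F′).  Summing the four
classes of `abs_boxSum_le_classes` over the boxes `(i, l) ∈ [0, I) × [0, I')` and the moduli
`q ∈ Q ⊆ [1, z]` (`0 < Δ ≤ 1`, `ΔK₀ ≥ 2`, `1 ≤ z`, `z² ≤ y`, `L_hi = log hi`):

* T: `≤ 4 V L_hi^j (Δ I' (1 + log z) + 8/Δ)`,
* P: `≤ 4 hi L_hi^j (Δ (1 + log z) + 4 z²/y)`,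
* H: `≤ 4 hi L_hi^j (Δ² I' (1 + log z) + 4 z²/y)`,
* F: `≤ 2 C_F hi L_hi^j Z I' / (log V)^{A'}`, given the bilinear input
  `∑_{q ∈ Q} |freeSum(q; i, l)| ≤ C_F Δ (MN) L_hi^j Z / log(MN)^{A'}` on the free boxes
  (supplied by `sum_abs_freeSum_le` of `SoloInformedTwinBoxBFI` in the final assembly).
-/

namespace Summit.Parity.BatemanHorn.Theorems

open Finset Real
open scoped ArithmeticFunction.Moebius
open Literature.NumberTheory.Sieve Literature.NumberTheory.Sieve.BFI

/-! ### 1. Modulus sums -/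

/-- `∑_{q ∈ Q} (a/q + b q) ≤ a (1 + log z) + b z²` for `Q ⊆ [1, z]`, `a, b ≥ 0`. -/
theorem sum_div_add_mul_le {z : ℕ} {Q : Finset ℕ} (hQ : Q ⊆ Icc 1 z) {a b : ℝ} (ha : 0 ≤ a)
    (hb : 0 ≤ b) : ∑ q ∈ Q, (a / q + b * q) ≤ a * (1 + Real.log z) + b * (z : ℝ) ^ 2 := by
  have e : ∀ q : ℕ, a / q + b * q = a * (1 / q) + b * q := fun q => by ring
  simp_rw [e]
  rw [Finset.sum_add_distrib, ← Finset.mul_sum, ← Finset.mul_sum]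
  exact add_le_add (mul_le_mul_of_nonneg_left (sum_one_div_le_of_subset_Icc hQ) ha)
    (mul_le_mul_of_nonneg_left (sum_self_le_sq_of_subset_Icc hQ) hb)

/-! ### 2. Class T -/

/-- **Class T total.** -/
theorem sum_classT_le (j : ℕ) {Δ : ℝ} (hΔ : 0 < Δ) (hΔ1 : Δ ≤ 1) {hi : ℕ} (hhi : 0 < hi)
    {K K₀ : ℕ} (hK₀ : 2 ≤ Δ * K₀) {y z : ℕ} (hz : 1 ≤ z) (hzy : (z : ℝ) ^ 2 ≤ y) {V : ℝ}
    (hV : 0 ≤ V) {Q : Finset ℕ} (hQ : Q ⊆ Icc 1 z) (I I' : ℕ) :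
    ∑ q ∈ Q, ∑ i ∈ range I, ∑ l ∈ range I',
      (if (K₀ : ℝ) < boxHigh (K : ℝ) Δ i ∧ 1 ≤ boxHigh (hi : ℝ) Δ l ∧
          ((y / q : ℕ) : ℝ) < boxHigh (hi : ℝ) Δ l ∧ boxLow (K : ℝ) Δ i * boxLow (hi : ℝ) Δ l ≤ hi ∧
          boxLow (K : ℝ) Δ i * boxLow (hi : ℝ) Δ l < V then boxTriv j hi K Δ q i l else 0) ≤
      4 * V * Real.log hi ^ j * (Δ * I' * (1 + Real.log z) + 8 / Δ) := by
  have hL : 0 ≤ Real.log hi ^ j := pow_nonneg (Real.log_natCast_nonneg hi) j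
  have hz' : (1 : ℝ) ≤ z := by exact_mod_cast hz
  have hy' : (0 : ℝ) < y := lt_of_lt_of_le (by positivity) hzy
  have hy : 0 < y := by exact_mod_cast hy'
  have hlogz : 0 ≤ Real.log z := Real.log_nonneg hz'
  set C := 4 * V * Real.log hi ^ j with hC
  have hC0 : 0 ≤ C := by positivity
  have hper : ∀ q ∈ Q, ∑ i ∈ range I, ∑ l ∈ range I',
      (if (K₀ : ℝ) < boxHigh (K : ℝ) Δ i ∧ 1 ≤ boxHigh (hi : ℝ) Δ l ∧
          ((y / q : ℕ) : ℝ) < boxHigh (hi : ℝ) Δ l ∧ boxLow (K : ℝ) Δ i * boxLow (hi : ℝ) Δ l ≤ hi ∧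
          boxLow (K : ℝ) Δ i * boxLow (hi : ℝ) Δ l < V then boxTriv j hi K Δ q i l else 0) ≤
      C * (Δ * I' / q + 8 * q / (Δ * y)) := by
    intro q hq
    have hq1 : 0 < q := (Finset.mem_Icc.1 (hQ hq)).1
    rw [Finset.sum_comm]
    calc ∑ l ∈ range I', ∑ i ∈ range I,
          (if (K₀ : ℝ) < boxHigh (K : ℝ) Δ i ∧ 1 ≤ boxHigh (hi : ℝ) Δ l ∧
            ((y / q : ℕ) : ℝ) < boxHigh (hi : ℝ) Δ l ∧
            boxLow (K : ℝ) Δ i * boxLow (hi : ℝ) Δ l ≤ hi ∧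
            boxLow (K : ℝ) Δ i * boxLow (hi : ℝ) Δ l < V then boxTriv j hi K Δ q i l else 0)
        ≤ ∑ l ∈ range I', (if 1 ≤ boxHigh (hi : ℝ) Δ l ∧ ((y / q : ℕ) : ℝ) < boxHigh (hi : ℝ) Δ l
            then C * (Δ / q + 1 / boxLow (hi : ℝ) Δ l) else 0) := by
          refine Finset.sum_le_sum fun l _ => ?_
          calc _ ≤ ∑ i ∈ range I, (if ((K₀ : ℝ) < boxHigh (K : ℝ) Δ i ∧
                  boxLow (K : ℝ) Δ i * boxLow (hi : ℝ) Δ l ≤ V) ∧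
                  (1 ≤ boxHigh (hi : ℝ) Δ l ∧ ((y / q : ℕ) : ℝ) < boxHigh (hi : ℝ) Δ l)
                  then boxTriv j hi K Δ q i l else 0) :=
                Finset.sum_le_sum fun i _ => ite_le_ite_of_imp
                  (fun h => ⟨⟨h.1, h.2.2.2.2.le⟩, h.2.1, h.2.2.1⟩) (boxTriv_nonneg hΔ.le _ _ _ _ _ _)
            _ ≤ _ := by
                have := sum_boxTriv_le_of_prod_le (K := K) hΔ hΔ1 hK₀ hhi hq1 hV
                  (1 ≤ boxHigh (hi : ℝ) Δ l ∧ ((y / q : ℕ) : ℝ) < boxHigh (hi : ℝ) Δ l) j l I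
                simpa only [hC] using this
      _ ≤ C * (Δ * I' / q + 8 * q / (Δ * y)) := sum_rowT_le hΔ hΔ1 hhi hq1 hy hC0 I'
  have e : ∀ q : ℕ, C * (Δ * I' / q + 8 * q / (Δ * y)) = (C * Δ * I') / q + (8 * C / (Δ * y)) * q :=
    fun q => by ring
  calc _ ≤ ∑ q ∈ Q, C * (Δ * I' / q + 8 * q / (Δ * y)) := Finset.sum_le_sum hper
    _ = ∑ q ∈ Q, ((C * Δ * I') / q + (8 * C / (Δ * y)) * q) := Finset.sum_congr rfl fun q _ => e q
    _ ≤ (C * Δ * I') * (1 + Real.log z) + (8 * C / (Δ * y)) * (z : ℝ) ^ 2 :=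
        sum_div_add_mul_le hQ (by positivity) (by positivity)
    _ ≤ (C * Δ * I') * (1 + Real.log z) + 8 * C / Δ := by
        have h1 : (8 * C / (Δ * y)) * (z : ℝ) ^ 2 = 8 * C / Δ * ((z : ℝ) ^ 2 / y) := by
          field_simp
        have h2 : (z : ℝ) ^ 2 / y ≤ 1 := (div_le_one hy').2 hzy
        rw [h1]
        nlinarith [mul_le_mul_of_nonneg_left h2 (show 0 ≤ 8 * C / Δ by positivity)]
    _ = 4 * V * Real.log hi ^ j * (Δ * I' * (1 + Real.log z) + 8 / Δ) := by rw [hC]; ring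

/-! ### 3. Class P -/

/-- **Class P total.** -/
theorem sum_classP_le (j : ℕ) {Δ : ℝ} (hΔ : 0 < Δ) (hΔ1 : Δ ≤ 1) {hi : ℕ} (hhi : 0 < hi)
    {K K₀ : ℕ} (hK₀ : 2 ≤ Δ * K₀) {y z : ℕ} (hz : 1 ≤ z) (hzy : (z : ℝ) ^ 2 ≤ y)
    {Q : Finset ℕ} (hQ : Q ⊆ Icc 1 z) (I I' : ℕ) :
    ∑ q ∈ Q, ∑ i ∈ range I, ∑ l ∈ range I',
      (if (K₀ : ℝ) < boxHigh (K : ℝ) Δ i ∧ 1 ≤ boxHigh (hi : ℝ) Δ l ∧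
          ((y / q : ℕ) : ℝ) < boxHigh (hi : ℝ) Δ l ∧ boxLow (K : ℝ) Δ i * boxLow (hi : ℝ) Δ l ≤ hi ∧
          boxLow (hi : ℝ) Δ l < ((y / q : ℕ) : ℝ) then boxTriv j hi K Δ q i l else 0) ≤
      4 * hi * Real.log hi ^ j * (Δ * (1 + Real.log z) + 4 * (z : ℝ) ^ 2 / y) := by
  have hL : 0 ≤ Real.log hi ^ j := pow_nonneg (Real.log_natCast_nonneg hi) j
  have hz' : (1 : ℝ) ≤ z := by exact_mod_cast hz
  have hy' : (0 : ℝ) < y := lt_of_lt_of_le (by positivity) hzy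
  have hy : 0 < y := by exact_mod_cast hy'
  set C := 4 * (hi : ℝ) * Real.log hi ^ j with hC
  have hC0 : 0 ≤ C := by positivity
  have hper : ∀ q ∈ Q, ∑ i ∈ range I, ∑ l ∈ range I',
      (if (K₀ : ℝ) < boxHigh (K : ℝ) Δ i ∧ 1 ≤ boxHigh (hi : ℝ) Δ l ∧
          ((y / q : ℕ) : ℝ) < boxHigh (hi : ℝ) Δ l ∧ boxLow (K : ℝ) Δ i * boxLow (hi : ℝ) Δ l ≤ hi ∧
          boxLow (hi : ℝ) Δ l < ((y / q : ℕ) : ℝ) then boxTriv j hi K Δ q i l else 0) ≤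
      C * (Δ / q + 4 * q / y) := by
    intro q hq
    have hq1 : 0 < q := (Finset.mem_Icc.1 (hQ hq)).1
    rw [Finset.sum_comm]
    calc ∑ l ∈ range I', ∑ i ∈ range I,
          (if (K₀ : ℝ) < boxHigh (K : ℝ) Δ i ∧ 1 ≤ boxHigh (hi : ℝ) Δ l ∧
            ((y / q : ℕ) : ℝ) < boxHigh (hi : ℝ) Δ l ∧
            boxLow (K : ℝ) Δ i * boxLow (hi : ℝ) Δ l ≤ hi ∧
            boxLow (hi : ℝ) Δ l < ((y / q : ℕ) : ℝ) then boxTriv j hi K Δ q i l else 0)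
        ≤ ∑ l ∈ range I', (if 1 ≤ boxHigh (hi : ℝ) Δ l ∧ ((y / q : ℕ) : ℝ) < boxHigh (hi : ℝ) Δ l ∧
            boxLow (hi : ℝ) Δ l < ((y / q : ℕ) : ℝ)
            then C * (Δ / q + 1 / boxLow (hi : ℝ) Δ l) else 0) := by
          refine Finset.sum_le_sum fun l _ => ?_
          calc _ ≤ ∑ i ∈ range I, (if ((K₀ : ℝ) < boxHigh (K : ℝ) Δ i ∧
                  boxLow (K : ℝ) Δ i * boxLow (hi : ℝ) Δ l ≤ hi) ∧
                  (1 ≤ boxHigh (hi : ℝ) Δ l ∧ ((y / q : ℕ) : ℝ) < boxHigh (hi : ℝ) Δ l ∧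
                    boxLow (hi : ℝ) Δ l < ((y / q : ℕ) : ℝ))
                  then boxTriv j hi K Δ q i l else 0) :=
                Finset.sum_le_sum fun i _ => ite_le_ite_of_imp
                  (fun h => ⟨⟨h.1, h.2.2.2.1⟩, h.2.1, h.2.2.1, h.2.2.2.2⟩)
                  (boxTriv_nonneg hΔ.le _ _ _ _ _ _)
            _ ≤ _ := by
                have := sum_boxTriv_le_of_prod_le (K := K) hΔ hΔ1 hK₀ hhi hq1 (Nat.cast_nonneg hi)
                  (1 ≤ boxHigh (hi : ℝ) Δ l ∧ ((y / q : ℕ) : ℝ) < boxHigh (hi : ℝ) Δ l ∧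
                    boxLow (hi : ℝ) Δ l < ((y / q : ℕ) : ℝ)) j l I
                simpa only [hC] using this
      _ ≤ C * (Δ / q + 4 * q / y) := sum_rowP_le hΔ hΔ1 hhi hq1 hy hC0 I'
  have e : ∀ q : ℕ, C * (Δ / q + 4 * q / y) = (C * Δ) / q + (4 * C / y) * q := fun q => by ring
  calc _ ≤ ∑ q ∈ Q, C * (Δ / q + 4 * q / y) := Finset.sum_le_sum hper
    _ = ∑ q ∈ Q, ((C * Δ) / q + (4 * C / y) * q) := Finset.sum_congr rfl fun q _ => e q
    _ ≤ (C * Δ) * (1 + Real.log z) + (4 * C / y) * (z : ℝ) ^ 2 :=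
        sum_div_add_mul_le hQ (by positivity) (by positivity)
    _ = 4 * hi * Real.log hi ^ j * (Δ * (1 + Real.log z) + 4 * (z : ℝ) ^ 2 / y) := by
        rw [hC]; ring

/-! ### 4. Class H -/

/-- **Class H total.** -/
theorem sum_classH_le (j : ℕ) {Δ : ℝ} (hΔ : 0 < Δ) (hΔ1 : Δ ≤ 1) {hi : ℕ} (hhi : 0 < hi)
    {K K₀ : ℕ} (hK₀ : 2 ≤ Δ * K₀) {y z : ℕ} (hz : 1 ≤ z) (hzy : (z : ℝ) ^ 2 ≤ y)
    {Q : Finset ℕ} (hQ : Q ⊆ Icc 1 z) (I I' : ℕ) :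
    ∑ q ∈ Q, ∑ i ∈ range I, ∑ l ∈ range I',
      (if (K₀ : ℝ) < boxHigh (K : ℝ) Δ i ∧ ((y / q : ℕ) : ℝ) ≤ boxLow (hi : ℝ) Δ l ∧
          boxLow (K : ℝ) Δ i * boxLow (hi : ℝ) Δ l ≤ hi ∧
          (hi : ℝ) < (1 + Δ) ^ 2 * (boxLow (K : ℝ) Δ i * boxLow (hi : ℝ) Δ l)
        then boxTriv j hi K Δ q i l else 0) ≤
      4 * hi * Real.log hi ^ j * (Δ ^ 2 * I' * (1 + Real.log z) + 4 * (z : ℝ) ^ 2 / y) := by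
  have hL : 0 ≤ Real.log hi ^ j := pow_nonneg (Real.log_natCast_nonneg hi) j
  have hz' : (1 : ℝ) ≤ z := by exact_mod_cast hz
  have hy' : (0 : ℝ) < y := lt_of_lt_of_le (by positivity) hzy
  have hzy' : z ≤ y := by
    have : (z : ℝ) ≤ (z : ℝ) ^ 2 := by nlinarith
    exact_mod_cast this.trans hzy
  set C := 4 * Δ * (hi : ℝ) * Real.log hi ^ j with hC
  have hC0 : 0 ≤ C := by positivity
  have hper : ∀ q ∈ Q, ∑ i ∈ range I, ∑ l ∈ range I',
      (if (K₀ : ℝ) < boxHigh (K : ℝ) Δ i ∧ ((y / q : ℕ) : ℝ) ≤ boxLow (hi : ℝ) Δ l ∧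
          boxLow (K : ℝ) Δ i * boxLow (hi : ℝ) Δ l ≤ hi ∧
          (hi : ℝ) < (1 + Δ) ^ 2 * (boxLow (K : ℝ) Δ i * boxLow (hi : ℝ) Δ l)
        then boxTriv j hi K Δ q i l else 0) ≤
      C * (Δ * I' / q + 4 * q / (Δ * y)) := by
    intro q hq
    have hq1 : 0 < q := (Finset.mem_Icc.1 (hQ hq)).1
    have hqz : q ≤ z := (Finset.mem_Icc.1 (hQ hq)).2
    rw [Finset.sum_comm]
    calc ∑ l ∈ range I', ∑ i ∈ range I,
          (if (K₀ : ℝ) < boxHigh (K : ℝ) Δ i ∧ ((y / q : ℕ) : ℝ) ≤ boxLow (hi : ℝ) Δ l ∧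
            boxLow (K : ℝ) Δ i * boxLow (hi : ℝ) Δ l ≤ hi ∧
            (hi : ℝ) < (1 + Δ) ^ 2 * (boxLow (K : ℝ) Δ i * boxLow (hi : ℝ) Δ l)
            then boxTriv j hi K Δ q i l else 0)
        ≤ ∑ l ∈ range I', (if ((y / q : ℕ) : ℝ) ≤ boxLow (hi : ℝ) Δ l
            then C * (Δ / q + 1 / boxLow (hi : ℝ) Δ l) else 0) := by
          refine Finset.sum_le_sum fun l _ => ?_
          calc _ ≤ ∑ i ∈ range I, (if ((K₀ : ℝ) < boxHigh (K : ℝ) Δ i ∧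
                  boxLow (K : ℝ) Δ i * boxLow (hi : ℝ) Δ l ≤ hi ∧
                  (hi : ℝ) < (1 + Δ) ^ 2 * (boxLow (K : ℝ) Δ i * boxLow (hi : ℝ) Δ l)) ∧
                  ((y / q : ℕ) : ℝ) ≤ boxLow (hi : ℝ) Δ l
                  then boxTriv j hi K Δ q i l else 0) :=
                Finset.sum_le_sum fun i _ => ite_le_ite_of_imp
                  (fun h => ⟨⟨h.1, h.2.2.1, h.2.2.2⟩, h.2.1⟩) (boxTriv_nonneg hΔ.le _ _ _ _ _ _)
            _ ≤ _ := by
                have := sum_boxTriv_hyper_le (K := K) hΔ hΔ1 hK₀ hhi hq1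
                  (((y / q : ℕ) : ℝ) ≤ boxLow (hi : ℝ) Δ l) j l I
                simpa only [hC] using this
      _ ≤ C * (Δ * I' / q + 4 * q / (Δ * y)) :=
          sum_rowH_le hΔ hΔ1 hhi hq1 (hqz.trans hzy') hC0 I'
  have e : ∀ q : ℕ, C * (Δ * I' / q + 4 * q / (Δ * y)) = (C * Δ * I') / q + (4 * C / (Δ * y)) * q :=
    fun q => by ring
  calc _ ≤ ∑ q ∈ Q, C * (Δ * I' / q + 4 * q / (Δ * y)) := Finset.sum_le_sum hper
    _ = ∑ q ∈ Q, ((C * Δ * I') / q + (4 * C / (Δ * y)) * q) := Finset.sum_congr rfl fun q _ => e q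
    _ ≤ (C * Δ * I') * (1 + Real.log z) + (4 * C / (Δ * y)) * (z : ℝ) ^ 2 :=
        sum_div_add_mul_le hQ (by positivity) (by positivity)
    _ = 4 * hi * Real.log hi ^ j * (Δ ^ 2 * I' * (1 + Real.log z) + 4 * (z : ℝ) ^ 2 / y) := by
        rw [hC]; field_simp

/-! ### 5. Class F -/

/-- **Class F total** from a bilinear input `hF` on the free boxes (a free box has
`K₀ < boxHigh_i`, `y/(2z) < N`, `(1+Δ)² MN ≤ hi`, `V ≤ MN`):  the F-class terms sum to at most
`2 C_F hi L_hi^j Z I' / (log V)^{A'}` (`V > 1`, `A' ≥ 0`; geometric cofactor sum). -/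
theorem sum_classF_le (j r₀ : ℕ) (a : ℤ) {Δ : ℝ} (hΔ : 0 < Δ) (hΔ1 : Δ ≤ 1) {hi : ℕ}
    (hhi : 0 < hi) (K K₀ : ℕ) {y z : ℕ} (hzy : z ≤ y) {V CF Z A' : ℝ} (hV : 1 < V)
    (hCF : 0 ≤ CF) (hZ : 0 ≤ Z) (hA' : 0 ≤ A') {Q : Finset ℕ} (hQ : Q ⊆ Icc 1 z) (I I' : ℕ)
    (hF : ∀ i l : ℕ, (K₀ : ℝ) < boxHigh (K : ℝ) Δ i → (y : ℝ) / (2 * z) < boxLow (hi : ℝ) Δ l →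
      (1 + Δ) ^ 2 * (boxLow (K : ℝ) Δ i * boxLow (hi : ℝ) Δ l) ≤ hi →
      V ≤ boxLow (K : ℝ) Δ i * boxLow (hi : ℝ) Δ l →
      ∑ q ∈ Q, |freeSum j r₀ hi a K₀ K Δ q i l| ≤
        CF * Δ * (boxLow (K : ℝ) Δ i * boxLow (hi : ℝ) Δ l) * Real.log hi ^ j * Z /
          Real.log (boxLow (K : ℝ) Δ i * boxLow (hi : ℝ) Δ l) ^ A') :
    ∑ q ∈ Q, ∑ i ∈ range I, ∑ l ∈ range I',
      (if (K₀ : ℝ) < boxHigh (K : ℝ) Δ i ∧ ((y / q : ℕ) : ℝ) ≤ boxLow (hi : ℝ) Δ l ∧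
          (1 + Δ) ^ 2 * (boxLow (K : ℝ) Δ i * boxLow (hi : ℝ) Δ l) ≤ hi ∧
          V ≤ boxLow (K : ℝ) Δ i * boxLow (hi : ℝ) Δ l
        then |freeSum j r₀ hi a K₀ K Δ q i l| else 0) ≤
      2 * CF * hi * Real.log hi ^ j * Z * I' / Real.log V ^ A' := by
  have hL : 0 ≤ Real.log hi ^ j := pow_nonneg (Real.log_natCast_nonneg hi) j
  have hlogV : 0 < Real.log V := Real.log_pos hV
  have hVA : 0 < Real.log V ^ A' := Real.rpow_pos_of_pos hlogV A'
  have h1Δ : 0 < 1 + Δ := by linarith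
  set D := CF * Real.log hi ^ j * Z / Real.log V ^ A' with hD
  have hD0 : 0 ≤ D := by positivity
  have hN : ∀ l, 0 < boxLow (hi : ℝ) Δ l := fun l => boxLow_pos (by exact_mod_cast hhi) (by linarith) l
  have hM0 : ∀ i, 0 ≤ boxLow (K : ℝ) Δ i := fun i => by unfold boxLow; positivity
  -- the bound for one box, summed over the moduli
  have hil : ∀ i l : ℕ, ∑ q ∈ Q,
      (if (K₀ : ℝ) < boxHigh (K : ℝ) Δ i ∧ ((y / q : ℕ) : ℝ) ≤ boxLow (hi : ℝ) Δ l ∧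
          (1 + Δ) ^ 2 * (boxLow (K : ℝ) Δ i * boxLow (hi : ℝ) Δ l) ≤ hi ∧
          V ≤ boxLow (K : ℝ) Δ i * boxLow (hi : ℝ) Δ l
        then |freeSum j r₀ hi a K₀ K Δ q i l| else 0) ≤
      (if boxLow (K : ℝ) Δ i ≤ hi / boxLow (hi : ℝ) Δ l then boxLow (K : ℝ) Δ i else 0) *
        (boxLow (hi : ℝ) Δ l * (Δ * D)) := by
    intro i l
    set M := boxLow (K : ℝ) Δ i with hM
    set N := boxLow (hi : ℝ) Δ l with hNdef
    have hNl := hN l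
    by_cases hG : (K₀ : ℝ) < boxHigh (K : ℝ) Δ i ∧ (y : ℝ) / (2 * z) < N ∧
        (1 + Δ) ^ 2 * (M * N) ≤ hi ∧ V ≤ M * N
    · have hMN : 0 < M * N := by linarith [hG.2.2.2]
      have hMle : M ≤ hi / N := by
        rw [le_div_iff₀ hNl]
        have h1 : (1 : ℝ) ≤ (1 + Δ) ^ 2 := by nlinarith
        have : M * N ≤ (1 + Δ) ^ 2 * (M * N) := by
          have := mul_le_mul_of_nonneg_right h1 hMN.le
          linarith
        linarith [hG.2.2.1]
      calc _ ≤ ∑ q ∈ Q, |freeSum j r₀ hi a K₀ K Δ q i l| :=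
            Finset.sum_le_sum fun q _ => by split_ifs <;> [exact le_rfl; exact abs_nonneg _]
        _ ≤ CF * Δ * (M * N) * Real.log hi ^ j * Z / Real.log (M * N) ^ A' :=
            hF i l hG.1 hG.2.1 hG.2.2.1 hG.2.2.2
        _ ≤ CF * Δ * (M * N) * Real.log hi ^ j * Z / Real.log V ^ A' :=
            div_le_div_of_nonneg_left (by positivity) hVA
              (Real.rpow_le_rpow hlogV.le (Real.log_le_log (by linarith) hG.2.2.2) hA')
        _ = (if M ≤ hi / N then M else 0) * (N * (Δ * D)) := by rw [if_pos hMle, hD]; ring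
    · have hzero : ∀ q ∈ Q,
          (if (K₀ : ℝ) < boxHigh (K : ℝ) Δ i ∧ ((y / q : ℕ) : ℝ) ≤ N ∧
              (1 + Δ) ^ 2 * (M * N) ≤ hi ∧ V ≤ M * N
            then |freeSum j r₀ hi a K₀ K Δ q i l| else 0) = 0 := by
        intro q hq
        have hq1 : 0 < q := (Finset.mem_Icc.1 (hQ hq)).1
        have hqz : q ≤ z := (Finset.mem_Icc.1 (hQ hq)).2
        rw [if_neg]
        rintro ⟨h1, h2, h3, h4⟩
        refine hG ⟨h1, lt_of_le_of_lt ?_ (boxLow_gt_of_uncut hq1 (hqz.trans hzy) h2), h3, h4⟩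
        have hq' : (0 : ℝ) < q := by exact_mod_cast hq1
        exact div_le_div_of_nonneg_left (Nat.cast_nonneg y) (by positivity)
          (by exact_mod_cast Nat.mul_le_mul_left 2 hqz)
      rw [Finset.sum_congr rfl hzero, Finset.sum_const_zero]
      split_ifs
      · exact mul_nonneg (hM0 i) (by positivity)
      · simp
  calc _ = ∑ i ∈ range I, ∑ l ∈ range I', ∑ q ∈ Q,
          (if (K₀ : ℝ) < boxHigh (K : ℝ) Δ i ∧ ((y / q : ℕ) : ℝ) ≤ boxLow (hi : ℝ) Δ l ∧ 
              (1 + Δ) ^ 2 * (boxLow (K : ℝ) Δ i * boxLow (hi : ℝ) Δ l) ≤ hi ∧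
              V ≤ boxLow (K : ℝ) Δ i * boxLow (hi : ℝ) Δ l
            then |freeSum j r₀ hi a K₀ K Δ q i l| else 0) := by
        rw [Finset.sum_comm]
        exact Finset.sum_congr rfl fun i _ => Finset.sum_comm
    _ ≤ ∑ i ∈ range I, ∑ l ∈ range I',
          (if boxLow (K : ℝ) Δ i ≤ hi / boxLow (hi : ℝ) Δ l then boxLow (K : ℝ) Δ i else 0) *
            (boxLow (hi : ℝ) Δ l * (Δ * D)) :=
        Finset.sum_le_sum fun i _ => Finset.sum_le_sum fun l _ => hil i l
    _ = ∑ l ∈ range I', (∑ i ∈ range I,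
          (if boxLow (K : ℝ) Δ i ≤ hi / boxLow (hi : ℝ) Δ l then boxLow (K : ℝ) Δ i else 0)) *
            (boxLow (hi : ℝ) Δ l * (Δ * D)) := by
        rw [Finset.sum_comm]
        exact Finset.sum_congr rfl fun l _ => by rw [Finset.sum_mul]
    _ ≤ ∑ l ∈ range I', ((1 + Δ) * (hi / boxLow (hi : ℝ) Δ l) / Δ) *
            (boxLow (hi : ℝ) Δ l * (Δ * D)) := by
        refine Finset.sum_le_sum fun l _ => mul_le_mul_of_nonneg_right ?_ ?_
        · exact sum_boxLow_indicator_le (Nat.cast_nonneg K) hΔ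
            (div_nonneg (Nat.cast_nonneg hi) (hN l).le) I
        · have := hN l; positivity
    _ = ∑ l ∈ range I', (1 + Δ) * hi * D := by
        refine Finset.sum_congr rfl fun l _ => ?_
        have := hN l
        field_simp
    _ = I' * ((1 + Δ) * hi * D) := by rw [Finset.sum_const, Finset.card_range, nsmul_eq_mul]
    _ ≤ I' * (2 * hi * D) := by
        refine mul_le_mul_of_nonneg_left ?_ (Nat.cast_nonneg I')
        have : 0 ≤ (hi : ℝ) * D := by positivity
        nlinarith
    _ = 2 * CF * hi * Real.log hi ^ j * Z * I' / Real.log V ^ A' := by rw [hD]; ring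

end Summit.Parity.BatemanHorn.Theorems
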